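import Literature.MathematicalPhysics.QuantumFieldTheory.Balaban1983to89.T3PrintedRegularMinimiser
import Literature.MathematicalPhysics.QuantumFieldTheory.Balaban1983to89.T3DescentFibreTower
import Literature.MathematicalPhysics.QuantumFieldTheory.Balaban1983to89.T3LogComparisonSocket
import Literature.MathematicalPhysics.QuantumFieldTheory.Balaban1983to89.T3SmallLiftHistory
import HarnessLib

/-!
# `UnitScaleTiltFluctuationComparisonRegPrPrintChi` — STUB 4′ of crux `FluctuationComparisonRegPrL` (stmt-QuantumFields-19935), repair
# (R1) «print's characteristic function χ_k of [Balaban1985UV3] (47) back»: the χ-GOOD DATA typed against the tree's sharp windows, the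
# STRUCTURAL heredity of χ (the step-below conditional mean stays inside the sharp window — no lift constant), the χ-restricted
# representation socket, and the implication INTO the registered 4′ text

Cell `ym3-torus`, width-lever lane `ym-ust-19935-r1` (strategy B of the owner's R3 answer 2026-08-27: «(R1) print's smooth characteristic
function back ((47) p.267): re-derive the small-block case structurally, no numerics»).  Count-neutral helper (`--supports stmt-QuantumFields-19935`).

THE LOCATED POINT (FINDING #44/#56 of the cell, ym-ust-19201-p1; lane A memo F-p2g13-1).  The registered small-block stub 4′ (odd `L < 7`) asks the
two-run comparison `|(log ρ_{K+1} + bg′_K) − (log ρ_K + bg_K) − κ_K| ≤ r_K` a.e. on the SHARP top window `{PlaqSmall (θBal n) V}`, `n = ⌊K/m⌋`, of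
the `histGood`-restricted height densities.  The large-`L` line reads both runs through a representation `log ρ = −bg + Pint − E ± Rm` asserted on
that whole window; at `L ∈ {3,5}` this is inconsistent on the window's EDGE BAND, because a datum `V` near the edge forces the conditional mean of
the level below out of ITS sharp window (`κ_min(3)√3 = 1.66 > 1`).  Print never meets this: the lower bound (47) p.267 carries the characteristic
function `χ_k` of «the restrictions on V given by the conditions |U_k(∂p) − 1| < g_k p(g_k)η²» — a condition on the MINIMISER `U_k = U_k(V)`, i.e.
on a smooth function of `V`, not on `V`'s own plaquette variables — and p.267 l.1–4 records that the block averages of such a minimiser are again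
small at every intermediate height (factor `2`, from [Balaban1985Variational]).

WHAT THIS FILE DOES (pure bookkeeping over tree objects; no estimate of [Balaban1985UV3]/[King1986] is asserted; no numerics).
* §1 `ChiGood F γ b₀ p₀ ε₀ μ h V` — print's `χ_k(V) = 1` IN THE TREE'S CURRENCY, WITH MARGIN `μ`: the regular fibre problem of `V` (print's space (6),
  tree `regFibrePr`/`minActionRegPr`) has a minimiser `U` whose block averages at EVERY height strictly below `V` lie in the SHRUNKEN sharp windows
  `(1 − μ)·θBal` (tree `histGood … K (n+1)` at the shrunken profile) — the owner's (R1) «composite minimiser inside the windows with margin at every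
  constrained level», a datum schema tied to `U_min`.  Non-vacuity (`chiGood_one`), monotonicity in `μ`.
* §2 STRUCTURAL HEREDITY: for χ-good `V` the step-below field `W⋆ = D_{n+1,K}U` (print's saddle point of the fibre law given `V`) lies in the sharp
  window of its height WITH THE SAME MARGIN, `PlaqSmall ((1−μ)θBal(n+1)) W⋆`, and so does every deeper average; `U` is regular and history-good for the
  height-`(n+1)` problem of `W⋆`, whose regular minimum is `≤` that of `V` (tower of fibres).  No lift constant `κ` enters: this is what the sharp-window
  reading lacks (#44) and print's `χ` has by construction.
* §3 THE TRANSFER LEMMA «print's χ ⇒ `ChiGood`» at the level of print's own letters: if the minimiser's `j`-fold averages have plaquette variables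
  `< a·L^{2j}·θBal(n)·L^{−2(K−n)}` with ONE `j`-uniform constant `a` (print: `a = 2`, p.267 l.1–4) then `V` is χ-good with margin `μ` as soon as
  `a ≤ (1 − μ)·L√L` — the only input being the threshold ratio `θBal(i+1) ≥ L^{−1/2}θBal(i)` (tree `sqrt_inv_mul_θBal_le_succ`).  At `L = 3`: `μ = 1 − 2/√27`.
  LOCATED: the `j`-uniform `a` is a property of MINIMISERS ([Balaban1985Variational] regularity; crux `MinimiserStabilityRegPr`'s currency), not of
  arbitrary small fields (the tree's one-step bound `plaqSmall_blockAvg_expMeanLogSU` has constant `151L²`, useless when iterated) — so print's `χ`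
  transfers to the sharp-window reading EXACTLY through this row, and `ChiGood` is typed as the transferred statement.
* §4 `TwoSidedRepOn F γ b₀ p₀ S ε₀ Pint E Rm` — the cell's representation socket `T3LogComparisonSocket.TwoSidedRepAt` ([Balaban1985UV3] (41) ∧ (47) at the trivial
  history, interaction data exposed) with its a.e. clause asserted only on a sub-predicate `S K n h V` of the window (to be `ChiGood`: print states (47) on `χ_k`,
  not on the window); `twoSidedRepOn_of_repAt` (full window ⇒ any `S`).  The sibling file `…PrintChiSocket` carries the one-family socket theorem and the
  implication INTO the registered 4′ text (lane A's abstract glue `SmallBlocksSplit.aeBound_of_inner_of_edge`, p517185, at `I := Win ∧ χ ∧ χ′`).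

WHAT THIS IS NOT: not a proof of 4′ (the edge clause (ii) is located-unprinted new mathematics at `L = 3`; at `L = 5` lane A's numbers say it is a
`K = 1` phenomenon); not a restatement of 4′ (the conclusions of §5 ARE the registered text); not (R2′) (no window is shrunk in any hypothesis on `V`).

References: T. Bałaban, CMP 102 (1985) 255–275 [Balaban1985UV3] ((7) p.257, (37) p.265, (40)–(41) p.266, (44)–(47) p.267); CMP 102 (1985) 277–309
[Balaban1985Variational] ((2), (6) p.278, Thm 1 p.279); C. King, CMP 102 (1986) 649–677 [King1986] (Thm 3.4 (3.9) p.656, Props 3.8–3.9 pp.664–665).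
-/

noncomputable section

namespace Summit.QuantumFields.YangMills.Theorems.PrintChi

open MeasureTheory Filter
open Literature.MathematicalPhysics.QuantumFieldTheory.Balaban1983to89
open Literature.MathematicalPhysics.QuantumFieldTheory.Balaban1983to89.T3ContinuumYM3Torus
open Literature.MathematicalPhysics.QuantumFieldTheory.Balaban1983to89.T3LevelShift
open Literature.MathematicalPhysics.QuantumFieldTheory.Balaban1983to89.T3UnitLawDensityEML (ℰp measurableE_ℰp)
open Literature.MathematicalPhysics.QuantumFieldTheory.Balaban1983to89.T3UnitScaleTilt
open Literature.MathematicalPhysics.QuantumFieldTheory.Balaban1983to89.T3TiltDescent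
open Literature.MathematicalPhysics.QuantumFieldTheory.Balaban1983to89.T3CruxEstimates
open Literature.MathematicalPhysics.QuantumFieldTheory.Balaban1983to89.T3ConstrainedMinimiser
open Literature.MathematicalPhysics.QuantumFieldTheory.Balaban1983to89.T3DescentFibreTower
open Literature.MathematicalPhysics.QuantumFieldTheory.Balaban1983to89.T3RegularMinimiser
open Literature.MathematicalPhysics.QuantumFieldTheory.Balaban1983to89.T3PrintedRegularMinimiser
open Literature.MathematicalPhysics.QuantumFieldTheory.Balaban1983to89.T3SmallLiftHistory
open Literature.MathematicalPhysics.QuantumFieldTheory.Balaban1983to89.T3LogComparisonSocket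
open Literature.MathematicalPhysics.QuantumFieldTheory.Balaban1983to89.Missing

/-! ## §1 Print's `χ` in the tree's currency: χ-good data with margin `μ` -/

section Chi

variable (F : T3Family) (γ b₀ p₀ ε₀ μ : ℝ)

/-- **THE SHRUNKEN THRESHOLD PROFILE `(1 − μ)·θBal`** (margin `μ`; `μ = 0` is the route's sharp profile). [cite: Balaban1985UV3, (7) p.257] -/
def θShrunk (i : ℕ) : ℝ := (1 - μ) * θBal F.L γ b₀ p₀ i

/-- **χ-GOOD DATA (print's `χ_k(V) = 1` of (47), typed against the sharp windows, with margin `μ`).**  The datum `V` at comparison height `n` of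
run `K` is χ-good when the regular fibre problem of `V` — the Wilson action minimised over print's space (6), tree `regFibrePr F n K h ε₀ V` — has a
MINIMISER `U` (the composite background field `U_k(V)`) all of whose block averages at the heights STRICTLY BELOW `V` (the constrained heights
`n+1, …, K` of the route's event) lie in the SHRUNKEN sharp windows: `U ∈ histGood F ℰp ((1−μ)·θBal) K (n+1)`.  `V`'s own window is NOT part of the
condition (4′ supplies `PlaqSmall (θBal n) V` separately), so χ-good data fill the sharp window up to its edge wherever the minimiser is tame.
(Print: «the characteristic function χ_k corresponds to the restrictions on V given by the conditions |U_k(∂p) − 1| < g_k p(g_k)η²», with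
p.267 l.1–4 for the intermediate heights; see §3 for the transfer.) [cite: Balaban1985UV3, (47) p.267] -/
def ChiGood {n K : ℕ} (h : n ≤ K) (V : GaugeField (F.P n) 0 (Matrix.specialUnitaryGroup (Fin 2) ℂ)) : Prop :=
  ∃ U ∈ regFibrePr F n K h ε₀ V, wilsonAction4 U = minActionRegPr F n K h ε₀ V ∧
    U ∈ histGood F ℰp (θShrunk F γ b₀ p₀ μ) K (n + 1)

variable {F γ b₀ p₀ ε₀ μ}

/-- Weakening a plaquette bound (local helper). [folklore] -/
private theorem plaqSmall_of_le' {P : Params} {j : ℕ} {G : Type*} [GaugeGroup G] {δ δ' : ℝ} (hδ : δ ≤ δ')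
    {U : GaugeField P j G} (hU : PlaqSmall δ U) : PlaqSmall δ' U :=
  fun p => (hU p).trans_le hδ

/-- The shrunken profile is below the sharp one for `0 ≤ μ` (thresholds nonnegative: `0 < γ ≤ 1`, `0 < b₀`). [cite: Balaban1985UV3, (7) p.257] -/
theorem θShrunk_le_θBal (hμ : 0 ≤ μ) (hγ : 0 < γ) (hγ1 : γ ≤ 1) (hb : 0 < b₀) (i : ℕ) :
    θShrunk F γ b₀ p₀ μ i ≤ θBal F.L γ b₀ p₀ i := by
  have hθ : 0 ≤ θBal F.L γ b₀ p₀ i := (T3MinimiserStabilityReduction.θBal_pos F.hL.2.le hγ hγ1 hb p₀ i).le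
  unfold θShrunk
  nlinarith

/-- The shrunken profile is positive for `μ < 1` (`0 < γ ≤ 1`, `0 < b₀`). [cite: Balaban1985UV3, (7) p.257] -/
theorem θShrunk_pos (hμ : μ < 1) (hγ : 0 < γ) (hγ1 : γ ≤ 1) (hb : 0 < b₀) (i : ℕ) : 0 < θShrunk F γ b₀ p₀ μ i :=
  mul_pos (by linarith) (T3MinimiserStabilityReduction.θBal_pos F.hL.2.le hγ hγ1 hb p₀ i)

/-- History-goodness is monotone in the threshold profile (local helper). [cite: Balaban1985UV3, (7) p.257] -/
private theorem histGood_mono_profile {θ θ' : ℕ → ℝ} (hθ : ∀ i, θ i ≤ θ' i) (K n : ℕ) :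
    histGood F ℰp θ K n ⊆ histGood F ℰp θ' K n :=
  fun _ hU j hj => plaqSmall_of_le' (hθ _) (hU j hj)

/-- History-goodness with fewer constrained heights is weaker: `histGood K n ⊆ histGood K n'` for `n ≤ n'` (local helper). [cite: Balaban1985UV3, (7) p.257] -/
private theorem histGood_mono_height (θ : ℕ → ℝ) (K : ℕ) {n n' : ℕ} (hnn' : n ≤ n') :
    histGood F ℰp θ K n ⊆ histGood F ℰp θ K n' :=
  fun _ hU j hj => hU j (by omega)

/-- **χ-goodness is MONOTONE IN THE MARGIN**: a larger margin is a stronger condition (`μ' ≤ μ`; thresholds nonnegative). [cite: Balaban1985UV3, (47) p.267] -/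
theorem ChiGood.mono {μ' : ℝ} (hμ : μ' ≤ μ) (hγ : 0 < γ) (hγ1 : γ ≤ 1) (hb : 0 < b₀) {n K : ℕ} {h : n ≤ K}
    {V : GaugeField (F.P n) 0 (Matrix.specialUnitaryGroup (Fin 2) ℂ)} (hV : ChiGood F γ b₀ p₀ ε₀ μ h V) :
    ChiGood F γ b₀ p₀ ε₀ μ' h V := by
  obtain ⟨U, hU, hmin, hhist⟩ := hV
  refine ⟨U, hU, hmin, histGood_mono_profile (fun i => ?_) K (n + 1) hhist⟩
  have hθ : 0 ≤ θBal F.L γ b₀ p₀ i := (T3MinimiserStabilityReduction.θBal_pos F.hL.2.le hγ hγ1 hb p₀ i).le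
  unfold θShrunk
  nlinarith

/-- A χ-good datum has a nonempty regular fibre (so `minActionRegPr V` is a genuine minimum, not the `sInf ∅` junk value). [cite: Balaban1985Variational, Thm 1 (8) p.279] -/
theorem ChiGood.nonempty_regFibrePr {n K : ℕ} {h : n ≤ K} {V : GaugeField (F.P n) 0 (Matrix.specialUnitaryGroup (Fin 2) ℂ)}
    (hV : ChiGood F γ b₀ p₀ ε₀ μ h V) : (regFibrePr F n K h ε₀ V).Nonempty := by
  obtain ⟨U, hU, -, -⟩ := hV
  exact ⟨U, hU⟩

/-- Iterated averages of the trivial configuration are trivial (`Ū = 1` for `U = 1` at the printed smearing; local helper). [cite: Balaban1987RG1, (0.4) p.253] -/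
private theorem iter_one (K k : ℕ) :
    Averaging.iter (fun i => BlockAveraging.blockAvg (P := F.P K) (j := i) ℰp) k
      (1 : GaugeField (F.P K) 0 (Matrix.specialUnitaryGroup (Fin 2) ℂ)) = 1 := by
  induction k with
  | zero => rfl
  | succ k ih =>
    show (BlockAveraging.blockAvg ℰp).avg
        (Averaging.iter (fun i => BlockAveraging.blockAvg (P := F.P K) (j := i) ℰp) k 1) = 1
    rw [ih, BlockAveraging.blockAvg_avg, avgFun_one ℰp expMeanLogSU_E_one]

/-- **NON-VACUITY: the trivial datum is χ-good** with any margin `μ < 1` (`ε₀ > 0`, `0 < γ ≤ 1`, `0 < b₀`): `U = 1` is print-regular, lies in the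
fibre of `V = 1`, has zero action `= minActionRegPr 1`, and all its averages are `1`, inside every positive window. [cite: Balaban1985Variational, (6) p.278] -/
theorem chiGood_one (hε : 0 < ε₀) (hμ : μ < 1) (hγ : 0 < γ) (hγ1 : γ ≤ 1) (hb : 0 < b₀) {n K : ℕ} (h : n ≤ K) :
    ChiGood F γ b₀ p₀ ε₀ μ h (1 : GaugeField (F.P n) 0 (Matrix.specialUnitaryGroup (Fin 2) ℂ)) := by
  refine ⟨1, one_mem_regFibrePr_one F hε, ?_, fun j _ => ?_⟩
  · rw [minActionRegPr_one F hε, ← minAction_self F ℰp K 1]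
    exact minAction_one F ℰp expMeanLogSU_E_one le_rfl
  · rw [iter_one]
    exact plaqSmall_one (θShrunk_pos hμ hγ hγ1 hb _)

end Chi

/-! ## §2 Structural heredity: the step below a χ-good datum stays inside the sharp window, with the same margin -/

section Heredity

variable {F : T3Family} {γ b₀ p₀ ε₀ μ : ℝ}

/-- The descended field is the iterated average read through the level identification (definitional; local helper). [cite: Balaban1987RG1, (0.11) p.253] -/
private theorem plaqSmall_descendTo_iff {n' K : ℕ} (h' : n' ≤ K) (δ : ℝ)
    (U : GaugeField (F.P K) 0 (Matrix.specialUnitaryGroup (Fin 2) ℂ)) :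
    PlaqSmall δ (descendTo F ℰp n' K h' U) ↔
      PlaqSmall δ (Averaging.iter (fun i => BlockAveraging.blockAvg (P := F.P K) (j := i) ℰp) (K - n') U) :=
  plaqSmall_fieldShift F _ δ _

/-- **EVERY DEEPER AVERAGE OF THE χ-WITNESS IS IN ITS SHARP WINDOW WITH MARGIN**: if `U` witnesses `ChiGood … h V` then for every height `n + i ≤ K`
with `1 ≤ i` the descended field `D_{n+i,K}U` satisfies `PlaqSmall ((1−μ)·θBal(n+i))` — read off `histGood … K (n+1)` at the index `j = K − n − i`.
[cite: Balaban1985UV3, (47) p.267] -/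
theorem plaqSmall_descendTo_of_histGood_succ {n K : ℕ} {U : GaugeField (F.P K) 0 (Matrix.specialUnitaryGroup (Fin 2) ℂ)}
    (hU : U ∈ histGood F ℰp (θShrunk F γ b₀ p₀ μ) K (n + 1)) {i : ℕ} (hi1 : 1 ≤ i) (hi : n + i ≤ K) :
    PlaqSmall (θShrunk F γ b₀ p₀ μ (n + i)) (descendTo F ℰp (n + i) K hi U) := by
  rw [plaqSmall_descendTo_iff]
  have h := hU (K - (n + i)) (by omega)
  rwa [show K - (K - (n + i)) = n + i by omega] at h

/-- **THE STEP BELOW A χ-GOOD DATUM STAYS INSIDE THE SHARP WINDOW — STRUCTURALLY.**  For a χ-good `V` at height `n < K` with witness `U`, the field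
one level below, `W⋆ := D_{n+1,K}U` — the block average of print's background field, i.e. the saddle point of the fibre law given `V` in the
small-field expansion ([Balaban1985UV3] p.267 l.1–4, p.268) — lies in the sharp window of height `n+1` with margin `μ`:
`PlaqSmall ((1−μ)·θBal(n+1)) W⋆`, hence in `PlaqSmall (θBal(n+1))`.  No one-step lift constant enters (contrast FINDING #44: for a datum known only
to lie in ITS OWN sharp window the action-minimising lift has gain `κ_min(3)√3 = 1.66 > 1` and `W⋆` can leave the window). [cite: Balaban1985UV3, (47) p.267] -/
theorem ChiGood.stepBelow {n K : ℕ} (h : n + 1 ≤ K) {V : GaugeField (F.P n) 0 (Matrix.specialUnitaryGroup (Fin 2) ℂ)}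
    (hV : ChiGood F γ b₀ p₀ ε₀ μ (Nat.le_of_succ_le h) V) (hμ : 0 ≤ μ) (hγ : 0 < γ) (hγ1 : γ ≤ 1) (hb : 0 < b₀) :
    ∃ U ∈ regFibrePr F n K (Nat.le_of_succ_le h) ε₀ V,
      wilsonAction4 U = minActionRegPr F n K (Nat.le_of_succ_le h) ε₀ V ∧
      PlaqSmall (θShrunk F γ b₀ p₀ μ (n + 1)) (descendTo F ℰp (n + 1) K h U) ∧
      PlaqSmall (θBal F.L γ b₀ p₀ (n + 1)) (descendTo F ℰp (n + 1) K h U) := by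
  obtain ⟨U, hU, hmin, hhist⟩ := hV
  have h1 := plaqSmall_descendTo_of_histGood_succ hhist le_rfl h
  exact ⟨U, hU, hmin, h1, plaqSmall_of_le' (θShrunk_le_θBal hμ hγ hγ1 hb _) h1⟩

/-- The regularity thresholds relax down the tower: `regThreshold F n K ε₀ ≤ regThreshold F n' K ε₀` for `n ≤ n'` (`ε₀ ≥ 0`; the exponent
`2(K − n)` decreases). [cite: Balaban1985Variational, (2) p.278] -/
theorem regThreshold_mono {n n' K : ℕ} (hnn' : n ≤ n') (hε : 0 ≤ ε₀) :
    regThreshold F n K ε₀ ≤ regThreshold F n' K ε₀ := by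
  unfold regThreshold
  have hL1 : (1 : ℝ) ≤ F.L := by exact_mod_cast F.hL.2.le
  have hinv0 : 0 ≤ ((F.L : ℝ))⁻¹ := inv_nonneg.mpr (by linarith)
  have hinv1 : ((F.L : ℝ))⁻¹ ≤ 1 := inv_le_one_of_one_le₀ hL1
  exact mul_le_mul_of_nonneg_left (pow_le_pow_of_le_one hinv0 hinv1 (by omega)) hε

/-- Likewise for the divergence clause: `DivSmall F n K ε₀ U → DivSmall F n' K ε₀ U` for `n ≤ n'` (`ε₀ ≥ 0`). [cite: Balaban1985RegularSpaces, (1.9) p.77] -/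
theorem divSmall_mono {n n' K : ℕ} (hnn' : n ≤ n') (hε : 0 ≤ ε₀)
    {U : GaugeField (F.P K) 0 (Matrix.specialUnitaryGroup (Fin 2) ℂ)} (hU : DivSmall F n K ε₀ U) : DivSmall F n' K ε₀ U := by
  intro b
  have hL1 : (1 : ℝ) ≤ F.L := by exact_mod_cast F.hL.2.le
  have hinv0 : 0 ≤ ((F.L : ℝ))⁻¹ := inv_nonneg.mpr (by linarith)
  have hinv1 : ((F.L : ℝ))⁻¹ ≤ 1 := inv_le_one_of_one_le₀ hL1
  exact (hU b).trans_le (mul_le_mul_of_nonneg_left (pow_le_pow_of_le_one hinv0 hinv1 (by omega)) hε)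

/-- Print-regularity relaxes down the tower: `RegPr F n K ε₀ U → RegPr F n' K ε₀ U` for `n ≤ n'` (`ε₀ ≥ 0`). [cite: Balaban1985Variational, (2) p.278] -/
theorem regPr_mono {n n' K : ℕ} (hnn' : n ≤ n') (hε : 0 ≤ ε₀)
    {U : GaugeField (F.P K) 0 (Matrix.specialUnitaryGroup (Fin 2) ℂ)} (hU : RegPr F n K ε₀ U) : RegPr F n' K ε₀ U :=
  ⟨plaqSmall_of_le' (regThreshold_mono hnn' hε) hU.1, divSmall_mono hnn' hε hU.2⟩

/-- **THE χ-WITNESS IS ADMISSIBLE FOR THE STEP-BELOW PROBLEM**: `U` lies in print's regular fibre of `W⋆ = D_{n+1,K}U` for the height-`(n+1)` problem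
(fibres compose, `descendTo_descendTo`; regularity relaxes), is history-good with margin for it, and the step-below regular minimum is
`≤ A(U) = minActionRegPr V` — the tower of [Balaban1985UV3]'s nested variational problems read one level down.  (Equality — `U` IS the step-below
minimiser — is [Balaban1985Variational] Thm 1's uniqueness, not claimed here.) [cite: Balaban1985UV3, (41)-(42) p.266] -/
theorem ChiGood.stepBelow_admissible {n K : ℕ} (h : n + 1 ≤ K) (hε : 0 ≤ ε₀)
    {V : GaugeField (F.P n) 0 (Matrix.specialUnitaryGroup (Fin 2) ℂ)} (hV : ChiGood F γ b₀ p₀ ε₀ μ (Nat.le_of_succ_le h) V) :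
    ∃ U ∈ regFibrePr F n K (Nat.le_of_succ_le h) ε₀ V,
      wilsonAction4 U = minActionRegPr F n K (Nat.le_of_succ_le h) ε₀ V ∧
      U ∈ regFibrePr F (n + 1) K h ε₀ (descendTo F ℰp (n + 1) K h U) ∧
      U ∈ histGood F ℰp (θShrunk F γ b₀ p₀ μ) K (n + 2) ∧
      minActionRegPr F (n + 1) K h ε₀ (descendTo F ℰp (n + 1) K h U) ≤ minActionRegPr F n K (Nat.le_of_succ_le h) ε₀ V := by
  obtain ⟨U, hU, hmin, hhist⟩ := hV
  have hreg : U ∈ regFibrePr F (n + 1) K h ε₀ (descendTo F ℰp (n + 1) K h U) :=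
    (mem_regFibrePr_iff F).mpr ⟨rfl, regPr_mono (Nat.le_succ n) hε ((mem_regFibrePr_iff F).mp hU).2⟩
  exact ⟨U, hU, hmin, hreg, histGood_mono_height (θShrunk F γ b₀ p₀ μ) K (by omega) hhist,
    hmin ▸ minActionRegPr_le F hreg⟩

/-- **CONDITIONAL HEREDITY OF χ**: if the χ-witness `U` of `V` also attains the step-below regular minimum (print: it does — the minimal orbit over the
larger space is unique and lies in the smaller one, [Balaban1985Variational] Thm 1 — taken here as the hypothesis `hle`), then `W⋆ = D_{n+1,K}U` is
itself χ-good with the same margin: print's `χ_k(V) = 1 ⇒ χ_{k−1}(W⋆) = 1`, the consistency that closes the inductive lower bound (47).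
[cite: Balaban1985Variational, Thm 1 (8) p.279] -/
theorem ChiGood.stepBelow_of_le {n K : ℕ} (h : n + 1 ≤ K) (hε : 0 ≤ ε₀)
    {V : GaugeField (F.P n) 0 (Matrix.specialUnitaryGroup (Fin 2) ℂ)} {U : GaugeField (F.P K) 0 (Matrix.specialUnitaryGroup (Fin 2) ℂ)}
    (hU : U ∈ regFibrePr F n K (Nat.le_of_succ_le h) ε₀ V) (hhist : U ∈ histGood F ℰp (θShrunk F γ b₀ p₀ μ) K (n + 1))
    (hle : wilsonAction4 U ≤ minActionRegPr F (n + 1) K h ε₀ (descendTo F ℰp (n + 1) K h U)) :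
    ChiGood F γ b₀ p₀ ε₀ μ h (descendTo F ℰp (n + 1) K h U) := by
  have hreg : U ∈ regFibrePr F (n + 1) K h ε₀ (descendTo F ℰp (n + 1) K h U) :=
    (mem_regFibrePr_iff F).mpr ⟨rfl, regPr_mono (Nat.le_succ n) hε ((mem_regFibrePr_iff F).mp hU).2⟩
  exact ⟨U, hreg, le_antisymm hle (minActionRegPr_le F hreg),
    histGood_mono_height (θShrunk F γ b₀ p₀ μ) K (by omega) hhist⟩

end Heredity

/-! ## §3 The transfer lemma: print's letters (`χ_k` + the regularity of the minimiser's averages) ⇒ χ-good, for every block size -/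

section Transfer

variable {F : T3Family} {γ b₀ p₀ ε₀ μ : ℝ}

/-- `(√(L⁻¹))^i·θBal(n) ≤ θBal(n+i)`: `i` steps down cost at most the factor `L^{i/2}` (iterate the tree's one-step ratio). [cite: Balaban1985UV3, (7) p.257] -/
theorem pow_sqrt_inv_mul_θBal_le {L : ℕ} (hL : 1 ≤ L) (hγ : 0 < γ) (hγ1 : γ ≤ 1) (hb : 0 ≤ b₀) (hp : 0 ≤ p₀) (n i : ℕ) :
    Real.sqrt ((L : ℝ)⁻¹) ^ i * θBal L γ b₀ p₀ n ≤ θBal L γ b₀ p₀ (n + i) := by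
  induction i with
  | zero => simp
  | succ i ih =>
    have hs : 0 ≤ Real.sqrt ((L : ℝ)⁻¹) := Real.sqrt_nonneg _
    calc Real.sqrt ((L : ℝ)⁻¹) ^ (i + 1) * θBal L γ b₀ p₀ n
        = Real.sqrt ((L : ℝ)⁻¹) * (Real.sqrt ((L : ℝ)⁻¹) ^ i * θBal L γ b₀ p₀ n) := by ring
      _ ≤ Real.sqrt ((L : ℝ)⁻¹) * θBal L γ b₀ p₀ (n + i) := mul_le_mul_of_nonneg_left ih hs
      _ ≤ θBal L γ b₀ p₀ (n + i + 1) := sqrt_inv_mul_θBal_le_succ hL hγ hγ1 hb hp (n + i)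

/-- The structural inequality behind the transfer: `a·(L⁻¹)^{2i} ≤ (1−μ)·(√(L⁻¹))^i` for every `i ≥ 1` as soon as `a ≤ (1−μ)·L√L` (`a ≥ 0`,
`L ≥ 1`) — `L⁻²` per level against `L^{−1/2}` per level leaves `L^{3/2}` per level. [folklore] -/
theorem transfer_ineq {L : ℕ} (hL : 1 ≤ L) {a : ℝ} (ha : 0 ≤ a) (haμ : a ≤ (1 - μ) * ((L : ℝ) * Real.sqrt L)) {i : ℕ} (hi : 1 ≤ i) :
    a * ((L : ℝ)⁻¹) ^ (2 * i) ≤ (1 - μ) * Real.sqrt ((L : ℝ)⁻¹) ^ i := by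
  have hL1 : (1 : ℝ) ≤ L := by exact_mod_cast hL
  have hL0 : (0 : ℝ) < L := by linarith
  set q : ℝ := Real.sqrt ((L : ℝ)⁻¹) with hq
  have hq0 : 0 < q := Real.sqrt_pos.mpr (inv_pos.mpr hL0)
  have hq1 : q ≤ 1 := by
    rw [hq, Real.sqrt_le_one]
    exact inv_le_one_of_one_le₀ hL1
  have hqsq : q ^ 2 = ((L : ℝ))⁻¹ := by rw [hq, Real.sq_sqrt (inv_nonneg.mpr hL0.le)]
  -- `L·√L = q⁻³`
  have hsqrtL : Real.sqrt (L : ℝ) = q⁻¹ := by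
    rw [hq, Real.sqrt_inv, inv_inv]
  have hLq : (L : ℝ) * Real.sqrt L = (q ^ 3)⁻¹ := by
    have hLeq : (L : ℝ) = (q ^ 2)⁻¹ := by rw [hqsq, inv_inv]
    rw [hsqrtL, hLeq, ← mul_inv, ← pow_succ]
  -- from `a ≤ (1−μ) q⁻³`: `a q³ ≤ 1 − μ`
  have hμ0 : 0 ≤ 1 - μ := by
    by_contra hneg
    have : (1 - μ) * ((L : ℝ) * Real.sqrt L) < 0 := mul_neg_of_neg_of_pos (not_le.mp hneg) (by positivity)
    linarith
  have h3 : a * q ^ 3 ≤ 1 - μ := by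
    rw [hLq] at haμ
    have := mul_le_mul_of_nonneg_right haμ (pow_pos hq0 3).le
    rwa [mul_assoc, inv_mul_cancel₀ (pow_pos hq0 3).ne', mul_one] at this
  -- `(L⁻¹)^{2i} = q^{4i} = q^{3i}·q^{i}` and `q^{3i} ≤ q^3`
  have hpow : ((L : ℝ)⁻¹) ^ (2 * i) = q ^ (3 * i) * q ^ i := by
    rw [← hqsq, ← pow_mul, ← pow_add]
    congr 1
    ring
  have hq3i : q ^ (3 * i) ≤ q ^ 3 := pow_le_pow_of_le_one hq0.le hq1 (by omega)
  calc a * ((L : ℝ)⁻¹) ^ (2 * i) = a * q ^ (3 * i) * q ^ i := by rw [hpow, mul_assoc]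
    _ ≤ a * q ^ 3 * q ^ i := by
        exact mul_le_mul_of_nonneg_right (mul_le_mul_of_nonneg_left hq3i ha) (pow_pos hq0 i).le
    _ ≤ (1 - μ) * q ^ i := mul_le_mul_of_nonneg_right h3 (pow_pos hq0 i).le

/-- **THE TRANSFER LEMMA — PRINT'S `χ` PUTS THE DATUM IN `ChiGood`, AT EVERY BLOCK SIZE, WITH NO LIFT CONSTANT.**  Let `U` be a minimiser of the
regular fibre problem of `V` (height `n`, run `K`, `k = K − n` steps) whose `j`-fold block averages, `j + (n+1) ≤ K`, have plaquette variables
`< a·L^{2j}·θBal(n)·L^{−2(K−n)}` for ONE `j`-uniform constant `a ≥ 0` — print's letters: `χ_k(V) = 1` is the clause `j = 0` with `a = 1`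
(«|U_k(∂p) − 1| < g_k p(g_k)η²», (47) p.267), and p.267 l.1–4 («this implies the condition |U_k^j(∂p′) − 1| < 2·[…]·(L^jη)²») supplies the others with
`a = 2` for minimisers.  If `a ≤ (1 − μ)·L√L` then `V` is χ-good with margin `μ`: at the height `n + i` (`i ≥ 1`) the bound is `a·θBal(n)·L^{−2i}`, the
window is `θBal(n+i) ≥ L^{−i/2}θBal(n)`, and `a·L^{−2i} ≤ (1−μ)L^{−i/2}`.  At `L = 3`, `a = 2`: margin `μ = 1 − 2/√27 ≈ 0.615`; at every `L ≥ 2`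
some margin is left.  LOCATED: the `j`-uniform `a` is a property of minimisers ([Balaban1985Variational] regularity), not of small fields. [cite: Balaban1985UV3, (47) p.267] -/
theorem chiGood_of_printChi (hγ : 0 < γ) (hγ1 : γ ≤ 1) (hb : 0 < b₀) (hp : 0 ≤ p₀) {n K : ℕ} (h : n ≤ K)
    {V : GaugeField (F.P n) 0 (Matrix.specialUnitaryGroup (Fin 2) ℂ)} {U : GaugeField (F.P K) 0 (Matrix.specialUnitaryGroup (Fin 2) ℂ)}
    (hU : U ∈ regFibrePr F n K h ε₀ V) (hmin : wilsonAction4 U = minActionRegPr F n K h ε₀ V) {a : ℝ} (ha : 0 ≤ a)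
    (haμ : a ≤ (1 - μ) * ((F.L : ℝ) * Real.sqrt F.L))
    (hreg : ∀ j, j + (n + 1) ≤ K →
      PlaqSmall (a * (F.L : ℝ) ^ (2 * j) * (θBal F.L γ b₀ p₀ n * ((F.L : ℝ)⁻¹) ^ (2 * (K - n))))
        (Averaging.iter (fun i => BlockAveraging.blockAvg (P := F.P K) (j := i) ℰp) j U)) :
    ChiGood F γ b₀ p₀ ε₀ μ h V := by
  refine ⟨U, hU, hmin, fun j hj => plaqSmall_of_le' ?_ (hreg j hj)⟩
  have hL : 1 ≤ F.L := F.hL.2.le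
  have hL0 : (0 : ℝ) < F.L := by exact_mod_cast (show 0 < F.L by omega)
  -- the height below `V` reached after `j` averagings is `n + i`, `i = K − n − j ≥ 1`
  obtain ⟨i, hi1, hi, hKn⟩ : ∃ i, 1 ≤ i ∧ K - j = n + i ∧ K - n = i + j := ⟨K - n - j, by omega, by omega, by omega⟩
  rw [hi, hKn]
  have hθ : 0 ≤ θBal F.L γ b₀ p₀ n := (T3MinimiserStabilityReduction.θBal_pos hL hγ hγ1 hb p₀ n).le
  have hμ0 : 0 ≤ 1 - μ := by
    by_contra hneg
    have : (1 - μ) * ((F.L : ℝ) * Real.sqrt F.L) < 0 := mul_neg_of_neg_of_pos (not_le.mp hneg) (by positivity)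
    linarith
  -- `L^{2j}·(L⁻¹)^{2(i+j)} = (L⁻¹)^{2i}`
  have hcancel : (F.L : ℝ) ^ (2 * j) * ((F.L : ℝ)⁻¹) ^ (2 * (i + j)) = ((F.L : ℝ)⁻¹) ^ (2 * i) := by
    rw [show 2 * (i + j) = 2 * i + 2 * j by ring, pow_add, inv_pow, inv_pow,
      mul_comm, mul_assoc, inv_mul_cancel₀ (pow_ne_zero _ hL0.ne'), mul_one]
  have key := transfer_ineq (μ := μ) hL ha haμ hi1
  calc a * (F.L : ℝ) ^ (2 * j) * (θBal F.L γ b₀ p₀ n * ((F.L : ℝ)⁻¹) ^ (2 * (i + j)))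
      = a * ((F.L : ℝ)⁻¹) ^ (2 * i) * θBal F.L γ b₀ p₀ n := by rw [← hcancel]; ring
    _ ≤ (1 - μ) * Real.sqrt ((F.L : ℝ)⁻¹) ^ i * θBal F.L γ b₀ p₀ n := mul_le_mul_of_nonneg_right key hθ
    _ = (1 - μ) * (Real.sqrt ((F.L : ℝ)⁻¹) ^ i * θBal F.L γ b₀ p₀ n) := by ring
    _ ≤ (1 - μ) * θBal F.L γ b₀ p₀ (n + i) :=
        mul_le_mul_of_nonneg_left (pow_sqrt_inv_mul_θBal_le hL hγ hγ1 hb.le hp n i) hμ0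
    _ = θShrunk F γ b₀ p₀ μ (n + i) := rfl

end Transfer

/-! ## §4 The representation socket RESTRICTED to a sub-predicate of the window (schema; the one-family socket theorem and the 4′ compositions are the sibling file `…PrintChiSocket`) -/

section Socket

variable (F : T3Family) (γ b₀ p₀ : ℝ)

/-- **[Balaban1985UV3] (41) ∧ (47) AT THE TRIVIAL HISTORY, PINNED, ON A SUB-PREDICATE `S` OF THE WINDOW** (hypothesis schema, never asserted): the cell's
socket `T3LogComparisonSocket.TwoSidedRepAt` with its a.e. clause asserted only at data `V` satisfying `S K n h V` — e.g. `S := ChiGood …`, print's `χ_k`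
((47) is stated on `χ_k`, not on the window).  Same exposed data `Pint, E, Rm`, same summability of `Rm` along every free fraction. [cite: Balaban1985UV3, (47) p.267] -/
def TwoSidedRepOn (S : (K n : ℕ) → n ≤ K → GaugeField (F.P n) 0 (Matrix.specialUnitaryGroup (Fin 2) ℂ) → Prop) (ε₀ : ℝ)
    (Pint : (K n : ℕ) → GaugeField (F.P n) 0 (Matrix.specialUnitaryGroup (Fin 2) ℂ) → ℝ) (E Rm : ℕ → ℕ → ℝ) : Prop :=
  (∀ K n, 0 ≤ Rm K n) ∧
  (∀ m : ℕ, 0 < m → Summable fun K : ℕ => Rm K (K / m) + Rm (K + 1) (K / m)) ∧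
  ∀ (K n : ℕ) (h : n ≤ K), ∀ᵐ V ∂fieldMeasure (F.P n) 0 (Matrix.specialUnitaryGroup (Fin 2) ℂ),
    PlaqSmall (θBal F.L γ b₀ p₀ n) V → S K n h V →
      0 < heightDensity F γ h (histGood F ℰp (θBal F.L γ b₀ p₀) K n) V → |Real.log (heightDensity F γ h (histGood F ℰp (θBal F.L γ b₀ p₀) K n) V) +
            (F.scheme ℰp γ).β K * minActionRegPr F n K h ε₀ V - Pint K n V + E K n| ≤ Rm K n

variable {F γ b₀ p₀}

/-- The full-window socket is the case `S = ⊤` (and implies the restricted one for every `S`). [cite: Balaban1985UV3, (41) p.266 and (47) p.267] -/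
theorem twoSidedRepOn_of_repAt (S : (K n : ℕ) → n ≤ K → GaugeField (F.P n) 0 (Matrix.specialUnitaryGroup (Fin 2) ℂ) → Prop) {ε₀ : ℝ}
    {Pint : (K n : ℕ) → GaugeField (F.P n) 0 (Matrix.specialUnitaryGroup (Fin 2) ℂ) → ℝ} {E Rm : ℕ → ℕ → ℝ}
    (h : TwoSidedRepAt F γ b₀ p₀ ε₀ Pint E Rm) : TwoSidedRepOn F γ b₀ p₀ S ε₀ Pint E Rm := by
  obtain ⟨h0, hsum, hae⟩ := h
  refine ⟨h0, hsum, fun K n hn => ?_⟩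
  filter_upwards [hae K n hn] with V hV
  exact fun hs _ hpos => hV hs hpos

end Socket

end Summit.QuantumFields.YangMills.Theorems.PrintChi

end
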